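import Literature.NumberTheory.LFunctions.DworkRationalityIntegralityProofs
import Literature.AlgebraicGeometry.Motives.ZetaFunctionProofs
import Literature.AlgebraicGeometry.Motives.VarietiesQuasiCompactProofs
import Mathlib.RingTheory.Polynomial.GaussLemma
import Mathlib.RingTheory.Polynomial.RationalRoot
import Mathlib.RingTheory.Localization.Integral
import Mathlib.RingTheory.PowerSeries.NoZeroDivisors
import HarnessLib

/-!
# Integrality of `Z(X, T)`, Fatou's lemma and Gauss's lemma (inputs to Deligne's (1.7) ⟹ (1.6))

Deligne, *La conjecture de Weil. I*, Publ. Math. IHÉS 43 (1974), proves his main theorem (1.6)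
("`det(1 - F*t, Hⁱ(X, ℚ_ℓ))` has integer coefficients independent of `ℓ`, and its complex
reciprocal roots have absolute value `q^{i/2}`") from the apparently weaker Lemma (1.7) (the
eigenvalues of `F*` on `Hⁱ` are algebraic numbers all of whose complex conjugates have absolute
value `q^{i/2}`) by an argument on pp. 276–277 whose arithmetic inputs are:

* `Z(X₀, t) ∈ ℤ⟦t⟧` with constant term `1` ("Regardons `Z(X₀, t)` comme une série formelle de
  terme constant 1, élément de `ℤ[[t]]`", p. 276) — because `Z` is the Euler product over the
  closed points, equivalently because `#X₀(𝔽_{qⁿ})` counts the fixed points of the iterates of a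
  permutation (Frobenius) of `X(𝔽̄_q)`;
* **Fatou's lemma** ("D'après un lemme de Fatou, que `Z(X₀, t)` soit dans `ℤ[[t]]` et de terme
  constant un implique que les termes constants de `P` et `Q₁` sont 1", p. 276, where
  `Z = P/Q₁` with `P, Q₁ ∈ ℤ[t]` coprime): a power series with integer coefficients and constant
  term `1` which is a rational function is the quotient of two coprime *integer* polynomials with
  constant terms `1`;
* **Gauss's lemma** ("D'après le lemme de Gauss … il est même à coefficients entiers", p. 277):
  a divisor with constant term `1` (over `ℚ`) of an integer polynomial with constant term `1` has
  integer coefficients.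

This file proves these three inputs; the reduction (1.7) ⟹ (1.6) itself is carried out in
`Literature/NumberTheory/LFunctions/WeilConjecturesDeligneReductionProofs.lean`.

## Main results

* `WeilFatou.exists_int_map_eq_zetaSeries`: for `X` of finite type over a finite field,
  `Z(X, T) ∈ ℤ⟦T⟧` with non-negative coefficients (Koblitz's Lemma V.1.1 applied to Frobenius
  permuting `X(k̄)`); `WeilFatou.exists_int_map_eq_zetaSeries_of_isSmoothProjective`: the same
  for `X` smooth projective.
* `WeilFatou.C_coeff_zero_dvd_of_coe_mul_eq_C` (core of Fatou's lemma): if `B ∈ ℤ[T]`,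
  `W ∈ ℤ⟦T⟧` and `B · W = N` is a non-zero constant, then `B(0)` divides every coefficient of `B`.
* `WeilFatou.exists_int_map_eq_of_isCoprime` (**Fatou's lemma**): if `Z ∈ ℤ⟦T⟧` and
  `Z · b = a` with `a, b ∈ ℚ[T]` coprime and `b(0) = 1`, then `a` and `b` have integer
  coefficients.
* `WeilFatou.exists_int_map_eq_of_dvd` (**Gauss's lemma**, constant-term-one form): if
  `Q ∈ ℚ[T]`, `Q(0) = 1`, divides (the image of) `B ∈ ℤ[T]` with `B(0) = 1`, then `Q` has
  integer coefficients.

## References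

* P. Deligne, *La conjecture de Weil. I*, Publ. Math. IHÉS 43 (1974), 273–307, proof of
  (1.7) ⟹ (1.6), pp. 276–277. [Deligne1974]
* N. Koblitz, *p-adic Numbers, p-adic Analysis, and Zeta-Functions*, 2nd ed., GTM 58 (1984),
  Ch. V §1, Lemma 1 (p. 120). [Koblitz1984]
* R. Hartshorne, *Algebraic Geometry* (1977), App. C, §1. [Hartshorne1977]

## Design notes

* No definitions are introduced; helpers live in `namespace Literature.NumberTheory.LFunctions.WeilFatou`.
* Fatou's lemma is proved by the `p`-adic argument: from a Bézout relation `uA + vB = N` over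
  `ℤ` one gets `B · W = N` in `ℤ⟦T⟧`; if a prime `p` divides `N`, then reducing modulo `p` in the
  integral domain `𝔽_p⟦T⟧` shows that `p` divides `B` or `W` coefficientwise, and one inducts on
  `|N|`.
* Gauss's lemma in the constant-term-one normalisation is deduced from Mathlib's monic version
  `IsIntegrallyClosed.eq_map_mul_C_of_dvd` by passing to reversed polynomials.
-/

universe u

open Polynomial

noncomputable section

namespace Literature.NumberTheory.LFunctions

namespace WeilFatou

/-! ### `Z(X, T)` has integer coefficients -/

section ZetaIntegral

open CategoryTheory _root_.AlgebraicGeometry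
open Literature.AlgebraicGeometry.Motives

variable {k : Type u} [Field k] [Finite k]

/-- The point counts `#X(𝔽_{q^m})` are the fixed-point counts of the iterates of the permutation
of `X(k̄)` given by the arithmetic Frobenius (Koblitz, Ch. V §1; Hartshorne, App. C §1).
[folklore] -/
theorem fixCount_toPerm_arithFrob (X : SchemeOver k) (m : ℕ) :
    Dwork.fixCount (MulAction.toPerm (arithFrob k) :
        Equiv.Perm (AlgPoints X (AlgebraicClosure k))) m = pointCount X m := by
  rw [Dwork.fixCount, pointCount, ← MulAction.toPermHom_apply, ← map_pow]
  rfl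

/-- **`Z(X, T) ∈ ℤ⟦T⟧`** for a scheme `X` of finite type over the finite field `k`: the zeta
function `Z(X, T) = exp(∑_{m ≥ 1} #X(𝔽_{q^m}) Tᵐ/m) ∈ ℚ⟦T⟧` is the image of a power series with
non-negative integer coefficients (Deligne, *Weil I*, p. 276: "`Z(X₀, t)` … série formelle de
terme constant 1, élément de `ℤ[[t]]`"; Koblitz, Ch. V §1, Lemma 1: sort the points of `X(𝔽̄_q)`
fixed by some power of Frobenius into Frobenius orbits, an orbit of length `d` contributing
`1/(1 - Tᵈ)`). Proof: `#X(𝔽_{q^m})` is the number of fixed points of the `m`-th iterate of the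
permutation `φ` of `X(k̄)` (`fixCount_toPerm_arithFrob`), these fixed-point sets are finite for
`X` of finite type (`finite_fixedPoints_arithFrob_pow_holds`), and Koblitz's Lemma 1 in its
abstract form `Dwork.exists_int_countZeta_fixCount` applies. [cite: Koblitz1984, Ch. V §1 Lemma 1]
[cite: Deligne1974, p. 276] -/
theorem exists_int_map_eq_zetaSeries (X : SchemeOver k) [LocallyOfFiniteType X.hom]
    [QuasiCompact X.hom] :
    ∃ Z : PowerSeries ℤ, (∀ n, 0 ≤ PowerSeries.coeff n Z) ∧
      Z.map (Int.castRingHom ℚ) = zetaSeries X := by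
  set φ : Equiv.Perm (AlgPoints X (AlgebraicClosure k)) := MulAction.toPerm (arithFrob k) with hφ
  have hfin : ∀ s, 0 < s → Finite {x : AlgPoints X (AlgebraicClosure k) // (φ ^ s) x = x} := by
    intro s hs
    have h := finite_fixedPoints_arithFrob_pow_holds (X := X) hs
    rw [hφ, ← MulAction.toPermHom_apply, ← map_pow]
    exact h
  obtain ⟨Z, hZ0, hZ⟩ := Dwork.exists_int_countZeta_fixCount φ hfin
  refine ⟨Z, hZ0, ?_⟩
  rw [hZ, Dwork.zetaSeries_eq_countZeta]
  congr 1
  funext s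
  rw [hφ, fixCount_toPerm_arithFrob]

/-- **`Z(X, T) ∈ ℤ⟦T⟧` for `X` smooth projective** over the finite field `k` (Deligne, *Weil I*,
p. 276): a smooth projective variety is of finite type (smooth ⟹ locally of finite type;
projective ⟹ quasi-compact, `IsSmoothProjective.quasiCompact_holds`), so
`exists_int_map_eq_zetaSeries` applies. [cite: Deligne1974, p. 276] -/
theorem exists_int_map_eq_zetaSeries_of_isSmoothProjective {n : ℕ} {X : SchemeOver k}
    (hX : IsSmoothProjective n X) :
    ∃ Z : PowerSeries ℤ, (∀ n, 0 ≤ PowerSeries.coeff n Z) ∧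
      Z.map (Int.castRingHom ℚ) = zetaSeries X := by
  have := hX.smoothOfRelativeDimension
  have : Smooth X.hom := SmoothOfRelativeDimension.smooth n X.hom
  have : QuasiCompact X.hom := IsSmoothProjective.quasiCompact_holds hX
  exact exists_int_map_eq_zetaSeries X

end ZetaIntegral

/-! ### Fatou's lemma -/

section FatouCore

/-- A power series all of whose coefficients are divisible by `a` is `a` times a power series.
[folklore] -/
theorem _root_.PowerSeries.exists_eq_C_mul_of_forall_dvd {R : Type*} [CommSemiring R] {a : R}
    {W : PowerSeries R} (h : ∀ n, a ∣ PowerSeries.coeff n W) :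
    ∃ W₁ : PowerSeries R, W = PowerSeries.C a * W₁ :=
  ⟨PowerSeries.mk fun n => (h n).choose, by
    ext n
    rw [PowerSeries.coeff_C_mul, PowerSeries.coeff_mk]
    exact (h n).choose_spec⟩

/-- Reduction modulo a prime detects divisibility of all coefficients of an integer polynomial.
[folklore] -/
theorem C_dvd_of_map_zmod_eq_zero {p : ℕ} [Fact p.Prime] {B : ℤ[X]}
    (h : B.map (Int.castRingHom (ZMod p)) = 0) : C (p : ℤ) ∣ B := by
  rw [C_dvd_iff_dvd_coeff]
  intro i
  have hi := congrArg (fun P : (ZMod p)[X] => P.coeff i) h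
  simp only [coeff_map, eq_intCast, coeff_zero] at hi
  exact (ZMod.intCast_zmod_eq_zero_iff_dvd _ p).mp hi

/-- Reduction modulo a prime detects divisibility of all coefficients of an integer power series.
[folklore] -/
theorem exists_eq_C_mul_of_map_zmod_eq_zero {p : ℕ} [Fact p.Prime] {W : PowerSeries ℤ}
    (h : W.map (Int.castRingHom (ZMod p)) = 0) :
    ∃ W₁ : PowerSeries ℤ, W = PowerSeries.C (p : ℤ) * W₁ := by
  refine PowerSeries.exists_eq_C_mul_of_forall_dvd fun n => ?_
  have hn := congrArg (PowerSeries.coeff n) h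
  simp only [PowerSeries.coeff_map, eq_intCast, map_zero] at hn
  exact (ZMod.intCast_zmod_eq_zero_iff_dvd _ p).mp hn

/-- **Core of Fatou's lemma.** If `B ∈ ℤ[T]`, `W ∈ ℤ⟦T⟧` and `B · W = N` with `N` a non-zero
integer, then the constant term `B(0)` divides `B` (i.e. all its coefficients). Proof by
induction on `|N|`: if `N = ±1` then `B(0) W(0) = ±1` and `B(0)` is a unit; otherwise pick a
prime `p ∣ N` and reduce modulo `p`: `𝔽_p⟦T⟧` is an integral domain, so `p` divides `B` or `W`
coefficientwise, and after dividing by `p` the induction hypothesis applies (this is the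
`p`-adic proof of Fatou's lemma invoked by Deligne, *Weil I*, p. 276). [cite: Deligne1974, p. 276] -/
theorem C_coeff_zero_dvd_of_coe_mul_eq_C :
    ∀ (m : ℕ) {N : ℤ} {B : ℤ[X]} {W : PowerSeries ℤ}, N.natAbs = m → N ≠ 0 →
      (B : PowerSeries ℤ) * W = PowerSeries.C N → C (B.coeff 0) ∣ B := by
  intro m
  induction m using Nat.strong_induction_on with
  | _ m ih =>
    intro N B W hm hN h
    by_cases h1 : N.natAbs = 1
    · -- `B(0) W(0) = N = ±1`, so `B(0)` is a unit
      have h0 := congrArg PowerSeries.constantCoeff h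
      rw [map_mul, Polynomial.constantCoeff_coe, PowerSeries.constantCoeff_C] at h0
      have hu : IsUnit (B.coeff 0) :=
        isUnit_of_dvd_unit (Dvd.intro _ h0) (Int.isUnit_iff_natAbs_eq.mpr h1)
      exact (Polynomial.isUnit_C.mpr hu).dvd
    · -- a prime `p ∣ N`
      obtain ⟨p, hp, hpN⟩ := Nat.exists_prime_and_dvd h1
      haveI : Fact p.Prime := ⟨hp⟩
      have hpN' : (p : ℤ) ∣ N := Int.ofNat_dvd_left.mpr hpN
      obtain ⟨N₁, rfl⟩ := hpN'
      have hp0 : (p : ℤ) ≠ 0 := Nat.cast_ne_zero.mpr hp.ne_zero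
      have hN₁ : N₁ ≠ 0 := fun h0 => hN (by rw [h0, mul_zero])
      have hlt : N₁.natAbs < m := by
        rw [← hm, Int.natAbs_mul, Int.natAbs_natCast]
        exact lt_mul_left (Int.natAbs_pos.mpr hN₁) hp.one_lt
      -- reduce modulo `p`
      have hmod : ((B.map (Int.castRingHom (ZMod p)) : (ZMod p)[X]) : PowerSeries (ZMod p)) *
          W.map (Int.castRingHom (ZMod p)) = 0 := by
        rw [Polynomial.polynomial_map_coe, ← map_mul, h, PowerSeries.map_C, eq_intCast,
          Int.cast_mul, Int.cast_natCast, ZMod.natCast_self, zero_mul, map_zero]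
      have hCp : PowerSeries.C (p : ℤ) ≠ 0 := fun h0 =>
        hp0 (PowerSeries.C_injective (h0.trans (map_zero _).symm))
      rcases mul_eq_zero.mp hmod with hB | hW
      · -- `p` divides `B`
        obtain ⟨B₁, rfl⟩ := C_dvd_of_map_zmod_eq_zero (Polynomial.coe_eq_zero_iff.mp hB)
        have h' : (B₁ : PowerSeries ℤ) * W = PowerSeries.C N₁ := by
          apply mul_left_cancel₀ hCp
          calc PowerSeries.C (p : ℤ) * ((B₁ : PowerSeries ℤ) * W)
              = ((C (p : ℤ) * B₁ : ℤ[X]) : PowerSeries ℤ) * W := by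
                rw [Polynomial.coe_mul, Polynomial.coe_C, mul_assoc]
            _ = PowerSeries.C ((p : ℤ) * N₁) := h
            _ = PowerSeries.C (p : ℤ) * PowerSeries.C N₁ := map_mul _ _ _
        have hdvd := ih _ hlt rfl hN₁ h'
        rw [coeff_C_mul, C_mul]
        exact mul_dvd_mul_left _ hdvd
      · -- `p` divides `W`
        obtain ⟨W₁, rfl⟩ := exists_eq_C_mul_of_map_zmod_eq_zero hW
        have h' : (B : PowerSeries ℤ) * W₁ = PowerSeries.C N₁ := by
          apply mul_left_cancel₀ hCp
          rw [mul_left_comm, h, ← map_mul]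
        exact ih _ hlt rfl hN₁ h'

end FatouCore

section Fatou

/-- Clearing denominators: every `p ∈ ℚ[T]` is `d⁻¹ P` with `P ∈ ℤ[T]` and `d` a non-zero
integer (Mathlib `IsLocalization.integerNormalization`). [folklore] -/
theorem exists_int_map_eq_C_mul (p : ℚ[X]) :
    ∃ (d : ℤ) (P : ℤ[X]), d ≠ 0 ∧ P.map (Int.castRingHom ℚ) = C (d : ℚ) * p := by
  obtain ⟨d, hd, hP⟩ := IsLocalization.integerNormalization_spec (nonZeroDivisors ℤ) p
  refine ⟨d, IsLocalization.integerNormalization (nonZeroDivisors ℤ) p, nonZeroDivisors.ne_zero hd,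
    ?_⟩
  rw [← algebraMap_int_eq, hP]
  ext n
  rw [coeff_smul, coeff_C_mul, zsmul_eq_mul]

/-- A polynomial over `ℚ` all of whose coefficients are (images of) integers is the image of an
integer polynomial. [folklore] -/
theorem exists_int_map_eq_of_forall_coeff {a : ℚ[X]} (h : ∀ n, ∃ z : ℤ, (z : ℚ) = a.coeff n) :
    ∃ A : ℤ[X], A.map (Int.castRingHom ℚ) = a := by
  rw [← Polynomial.mem_lifts, Polynomial.lifts_iff_coeff_lifts]
  intro n
  obtain ⟨z, hz⟩ := h n
  exact ⟨z, by rw [eq_intCast, hz]⟩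

/-- **Fatou's lemma** (Deligne, *Weil I*, p. 276: "D'après un lemme de Fatou, que `Z(X₀, t)` soit
dans `ℤ[[t]]` et de terme constant un implique que les termes constants de `P` et `Q₁` sont 1";
equivalently, in the normalisation used here): let `Z ∈ ℤ⟦T⟧` and suppose `Z · b = a` in `ℚ⟦T⟧`
with `a, b ∈ ℚ[T]` coprime and `b(0) = 1`. Then `a` and `b` have integer coefficients. Proof: a
Bézout relation `ua + vb = 1` gives `b · (uZ + v) = 1`; clearing denominators,
`B · W = N ≠ 0` in `ℤ⟦T⟧` with `B = d·b ∈ ℤ[T]`, so `B(0) = d` divides `B`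
(`C_coeff_zero_dvd_of_coe_mul_eq_C`), i.e. `b = B/d ∈ ℤ[T]`; and `a = Z · b`.
[cite: Deligne1974, p. 276] -/
theorem exists_int_map_eq_of_isCoprime {Z : PowerSeries ℤ} {a b : ℚ[X]} (hab : IsCoprime a b)
    (hb0 : b.coeff 0 = 1) (hZ : Z.map (Int.castRingHom ℚ) * b = a) :
    ∃ A B : ℤ[X], A.map (Int.castRingHom ℚ) = a ∧ B.map (Int.castRingHom ℚ) = b := by
  have hfi : Function.Injective (Int.castRingHom ℚ) := Int.cast_injective
  obtain ⟨u, v, huv⟩ := hab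
  obtain ⟨db, Bz, hdb, hBz⟩ := exists_int_map_eq_C_mul b
  obtain ⟨du, U, hdu, hU⟩ := exists_int_map_eq_C_mul u
  obtain ⟨dv, V, hdv, hV⟩ := exists_int_map_eq_C_mul v
  -- the identity `B · W = N` in `ℤ⟦T⟧`
  have hBW : (Bz : PowerSeries ℤ) *
      (PowerSeries.C dv * ((U : PowerSeries ℤ) * Z) + PowerSeries.C du * (V : PowerSeries ℤ)) =
      PowerSeries.C (db * du * dv) := by
    apply PowerSeries.map_injective (Int.castRingHom ℚ) hfi
    have hb1 : (b : PowerSeries ℚ) * ((u : PowerSeries ℚ) * Z.map (Int.castRingHom ℚ) + v) = 1 :=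
      calc (b : PowerSeries ℚ) * ((u : PowerSeries ℚ) * Z.map (Int.castRingHom ℚ) + v)
          = (u : PowerSeries ℚ) * (Z.map (Int.castRingHom ℚ) * b) + v * b := by ring
        _ = 1 := by
          rw [hZ, ← Polynomial.coe_mul, ← Polynomial.coe_mul, ← Polynomial.coe_add, huv,
            Polynomial.coe_one]
    rw [map_mul, map_add, map_mul, map_mul, map_mul, ← Polynomial.polynomial_map_coe,
      ← Polynomial.polynomial_map_coe, ← Polynomial.polynomial_map_coe, hBz, hU, hV,
      PowerSeries.map_C, PowerSeries.map_C, PowerSeries.map_C, Polynomial.coe_mul,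
      Polynomial.coe_mul, Polynomial.coe_mul, Polynomial.coe_C, Polynomial.coe_C, Polynomial.coe_C,
      eq_intCast, eq_intCast, eq_intCast, Int.cast_mul, Int.cast_mul, map_mul, map_mul]
    linear_combination
      (PowerSeries.C (db : ℚ) * PowerSeries.C (du : ℚ) * PowerSeries.C (dv : ℚ)) * hb1
  have hN : db * du * dv ≠ 0 := mul_ne_zero (mul_ne_zero hdb hdu) hdv
  -- Fatou core: `B(0) ∣ B`, and `B(0) = db`
  obtain ⟨B', hB'⟩ := C_coeff_zero_dvd_of_coe_mul_eq_C _ rfl hN hBW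
  have hB0 : Bz.coeff 0 = db := by
    apply hfi
    have h0 := congrArg (fun P : ℚ[X] => P.coeff 0) hBz
    simp only [coeff_map, coeff_C_mul, hb0, mul_one] at h0
    rw [h0, eq_intCast]
  have hb : B'.map (Int.castRingHom ℚ) = b := by
    have h1 : (C (db : ℚ)) * B'.map (Int.castRingHom ℚ) = C (db : ℚ) * b := by
      rw [← hBz, hB', hB0, Polynomial.map_mul, map_C, eq_intCast]
    exact mul_left_cancel₀ (mt C_eq_zero.mp (Int.cast_ne_zero.mpr hdb)) h1
  -- `a = Z · b` has integer coefficients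
  obtain ⟨A, hA⟩ := exists_int_map_eq_of_forall_coeff (a := a) fun n =>
    ⟨PowerSeries.coeff n (Z * B'), by
      rw [← Polynomial.coeff_coe, ← hZ, ← hb, Polynomial.polynomial_map_coe, ← map_mul,
        PowerSeries.coeff_map, eq_intCast]⟩
  exact ⟨A, B', hA, hb⟩

end Fatou

/-! ### Gauss's lemma for polynomials with constant term one -/

section Gauss

/-- `reverse` commutes with `map` along an injective ring homomorphism (degrees are preserved).
[folklore] -/
theorem reverse_map_of_injective {R S : Type*} [Semiring R] [Semiring S] {f : R →+* S}
    (hf : Function.Injective f) (p : R[X]) : (p.map f).reverse = p.reverse.map f := by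
  rw [reverse, natDegree_map_eq_of_injective hf, reflect_map, reverse]

/-- A polynomial with non-zero constant term is the reverse of its reverse. [folklore] -/
theorem reverse_reverse_of_coeff_zero_ne_zero {R : Type*} [Semiring R] {f : R[X]}
    (hf : f.coeff 0 ≠ 0) : f.reverse.reverse = f := by
  have h0 : f.natTrailingDegree = 0 := natTrailingDegree_eq_zero.mpr (Or.inr hf)
  have hd : f.reverse.natDegree = f.natDegree := by rw [reverse_natDegree, h0, Nat.sub_zero]
  rw [reverse, hd, reverse, reflect_reflect]

/-- The reverse of a polynomial with constant term `1` is monic. [folklore] -/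
theorem monic_reverse_of_coeff_zero_eq_one {R : Type*} [Semiring R] [Nontrivial R] {f : R[X]}
    (hf : f.coeff 0 = 1) : f.reverse.Monic := by
  have h0 : f.natTrailingDegree = 0 :=
    natTrailingDegree_eq_zero.mpr (Or.inr (by rw [hf]; exact one_ne_zero))
  rw [Monic, reverse_leadingCoeff, trailingCoeff, h0, hf]

/-- **Gauss's lemma, constant-term-one form** (Deligne, *Weil I*, p. 277: "D'après le lemme de
Gauss (ou parce que les racines de `Pᵢ`, étant racines de `R(t)`, sont des inverses d'entiers
algébriques), il est même à coefficients entiers"). If `Q ∈ ℚ[T]` with `Q(0) = 1` divides (the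
image of) an integer polynomial `B` with `B(0) = 1`, then `Q` has integer coefficients. Proof:
`Q^rev` divides the *monic* integer polynomial `B^rev`, so by Mathlib's
`IsIntegrallyClosed.eq_map_mul_C_of_dvd` (`ℤ` is integrally closed) `Q^rev`, whose leading
coefficient is `Q(0) = 1`, is integral; and `Q = (Q^rev)^rev`. [cite: Deligne1974, p. 277] -/
theorem exists_int_map_eq_of_dvd {B : ℤ[X]} (hB0 : B.coeff 0 = 1) {Q : ℚ[X]} (hQ0 : Q.coeff 0 = 1)
    (hdvd : Q ∣ B.map (Int.castRingHom ℚ)) : ∃ P : ℤ[X], P.map (Int.castRingHom ℚ) = Q := by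
  have hfi : Function.Injective (algebraMap ℤ ℚ) := Int.cast_injective
  rw [← algebraMap_int_eq] at hdvd ⊢
  have hrev : Q.reverse ∣ B.reverse.map (algebraMap ℤ ℚ) := by
    obtain ⟨c, hc⟩ := hdvd
    refine ⟨c.reverse, ?_⟩
    rw [← reverse_map_of_injective hfi, hc, reverse_mul_of_domain]
  obtain ⟨g, hg⟩ :=
    IsIntegrallyClosed.eq_map_mul_C_of_dvd (K := ℚ) (monic_reverse_of_coeff_zero_eq_one hB0) hrev
  rw [(monic_reverse_of_coeff_zero_eq_one hQ0).leadingCoeff, C_1, mul_one] at hg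
  refine ⟨g.reverse, ?_⟩
  rw [← reverse_map_of_injective hfi, hg,
    reverse_reverse_of_coeff_zero_ne_zero (by rw [hQ0]; exact one_ne_zero)]

end Gauss

end WeilFatou

end Literature.NumberTheory.LFunctions

end
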